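import Summits.RiemannHypothesis.RiemannHypothesis.Theorems.WeilFormatCCinfExactTables
import Literature.NumberTheory.LFunctions.YoshidaWindowGramColumnData
import HarnessLib

/-!
# Format C, design C∞ (E2, data side): PACKED claimed tables — the bridge from format-C `Encl.DataNear` to `CinfExact.TabNear`

Route context: Fourier–Galerkin / Schur-complement certificates of Weil positivity on a window ("format C", C∞ door
`weilPositivityOn_of_cinf_cert`, `WeilFormatCCinfDoorCert`; supporting stmt-RiemannHypothesis-0098; seat rh-explicit-weil-2,
cell memo `run/shared/lean/pub/rh-explicit/rh-explicit-weil-2/gen16/E2F-CERT-PIPELINE.md` §4–§5).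

The exact-integer stages (`WeilFormatCCinfCertStageT/L/E`) consume PRIMITIVE claimed tables in the uniform shape
`CinfExact.TabNear f n k c ρ Z` (`|f i j − Z[i][j]/2^c| ≤ ρ/2^c`).  The format-C data kit
(`Literature…YoshidaWindowGramColumnData`, namespace `Encl`) already certifies two-index data as PACKED natural rows:
`Encl.DataNear f B K w o c ρ XP` (`|f i t − (digit − o)·2^{−c}| ≤ ρ·2^{−c}`, digits of width `w` read from the packed row
`XP[i]`), produced chunkwise from ANY interval evaluator `box i t ∋ f i t` by the Boolean `Encl.checkRect`.  This file is the
10-line bridge announced in the memo (§5 (d)):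

* `CinfPacked.ofPacked w K o XP` — the packed rows as a signed table (`PsdDyadic.unpackRow (2^w) o`; a `def`-map, so the
  kernel unpacks each row once and memoises it);
* `getMZ_ofPacked` — its entries ARE `digit − o`;
* ★ `TabNear.of_dataNear` — `Encl.DataNear f B K w o c ρ XP → B ≤ |XP| → CinfExact.TabNear f B K c ρ (ofPacked w K o XP)`;
* `dataNear_extendRows` / `tabNear_of_checkRect` — the GENERIC producer: any `box` with `f i t ∈ box i t` and a passing
  `Encl.checkRect` give `DataNear` (row band by row band) resp. `TabNear` (one rectangle) — the uniform validator shape for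
  every primitive of the pipeline (K-columns via `sectorColBox`, Fourier tables, mixed window boxes, prime rows, …);
* `sectorKernel_false_apply` / `sectorKernel_true_apply` — the format-C sector kernels `sectorKernel odd (gramCoeff a)` ARE the
  door's printed `Kb` lambdas (even / odd), so `Encl.colDataNear_extendRows` feeds the K-tables of the pipeline verbatim.

Bookkeeping only; standard axioms; no RH claim.
-/

set_option autoImplicit false
-- `Summit.RiemannHypothesis.RiemannHypothesis.…` is the layout-mandated namespace (summit = problem name).
set_option linter.dupNamespace false

namespace Summit.RiemannHypothesis.RiemannHypothesis.Theorems.WeilFormatC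

namespace CinfPacked

open Literature.NumberTheory.LFunctions Literature.NumberTheory.LFunctions.Yoshida1992
open Literature.Analysis.ValidatedNumerics.NumericsMP

/-! ## Packed rows as a signed table -/

/-- The packed natural rows `XP` (word width `w`, `K` digits per row, offset `o`) as a signed integer table:
row `i` is `PsdDyadic.unpackRow (2^w) o XP[i] K`, i.e. its digits minus the offset. -/
def ofPacked (w K o : ℕ) (XP : List ℕ) : List (List ℤ) := XP.map fun r ↦ PsdDyadic.unpackRow (2 ^ w) o r K

/-- `ofPacked` has one row per packed row. -/
theorem length_ofPacked (w K o : ℕ) (XP : List ℕ) : (ofPacked w K o XP).length = XP.length := by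
  rw [ofPacked, List.length_map]

/-- The signed digits of `PsdDyadic.unpackRow` are the natural digits of `Encl.unpackNats` minus the offset. -/
theorem unpackRow_getD (w o : ℕ) : ∀ (r K t : ℕ), t < K →
    (PsdDyadic.unpackRow (2 ^ w) o r K).getD t 0 = ((Encl.unpackNats w r K).getD t 0 : ℤ) - o
  | _, 0, t, ht => absurd ht (Nat.not_lt_zero t)
  | r, K + 1, 0, _ => by simp [PsdDyadic.unpackRow, Encl.unpackNats]
  | r, K + 1, t + 1, ht => by
      simp only [PsdDyadic.unpackRow, Encl.unpackNats, List.getD_cons_succ]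
      exact unpackRow_getD w o (r / 2 ^ w) K t (by omega)

/-- **Entries of the packed table**: `ofPacked[i][t] = digit − o` for `i < |XP|`, `t < K`. -/
theorem getMZ_ofPacked {w K o : ℕ} {XP : List ℕ} {i t : ℕ} (hi : i < XP.length) (ht : t < K) :
    PsdDyadic.getMZ (ofPacked w K o XP) i t = (Encl.digit w K XP i t : ℤ) - o := by
  have h1 : (ofPacked w K o XP).getD i [] = PsdDyadic.unpackRow (2 ^ w) o (XP.getD i 0) K := by
    rw [ofPacked, List.getD_eq_getElem?_getD, List.getElem?_map, List.getElem?_eq_getElem hi, Option.map_some,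
      Option.getD_some, List.getD_eq_getElem?_getD, List.getElem?_eq_getElem hi, Option.getD_some]
  rw [PsdDyadic.getMZ, h1, unpackRow_getD w o _ K t ht, Encl.digit]

/-! ## The bridge -/

/-- ★ **`Encl.DataNear` ⇒ `CinfExact.TabNear`** on the packed table (the table must have at least `B` rows). -/
theorem TabNear.of_dataNear {f : ℕ → ℕ → ℝ} {B K w o c ρ : ℕ} {XP : List ℕ}
    (h : Encl.DataNear f B K w o c ρ XP) (hB : B ≤ XP.length) :
    CinfExact.TabNear f B K c ρ (ofPacked w K o XP) := by
  refine ⟨fun i hi t ht ↦ ?_⟩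
  have h1 := h i hi t ht
  rw [getMZ_ofPacked (by omega) ht]
  simpa only [mul_one_div] using h1

/-! ## The generic producer: any interval evaluator + `Encl.checkRect` -/

/-- **Row-band extension** for an ARBITRARY evaluator: if `f i t ∈ box i t` on the band `n ≤ i < n + ki`, `t < K`, and
`Encl.checkRect` passes on that band (all `K` digits), the packed data encloses `f` below row `n + ki`. -/
theorem dataNear_extendRows {S : ℕ} (hS : 0 < S) {f : ℕ → ℕ → ℝ} {box : ℕ → ℕ → MI} {K w o c ρ n ki : ℕ}
    {XP : List ℕ} (hbox : ∀ i, n ≤ i → i < n + ki → ∀ t < K, MI.mem S (f i t) (box i t))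
    (h1 : Encl.DataNear f n K w o c ρ XP) (h : Encl.checkRect S c (ρ : ℤ) w K o box XP n ki 0 K = true) :
    Encl.DataNear f (n + ki) K w o c ρ XP :=
  Encl.DataNear.extendRows h1 fun i hi hik t ht ↦ by
    have h2 := Encl.near_of_checkRect hS (f := f)
      (fun i hi hik t _ htk ↦ hbox i hi hik t (by simpa using htk)) h hi hik (Nat.zero_le t) (by simpa using ht)
    exact_mod_cast h2

/-- **One-rectangle form**: a small table checked in one go is a `TabNear` fact on the packed table. -/
theorem tabNear_of_checkRect {S : ℕ} (hS : 0 < S) {f : ℕ → ℕ → ℝ} {box : ℕ → ℕ → MI} {B K w o c ρ : ℕ}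
    {XP : List ℕ} (hbox : ∀ i < B, ∀ t < K, MI.mem S (f i t) (box i t))
    (h : Encl.checkRect S c (ρ : ℤ) w K o box XP 0 B 0 K = true) (hB : B ≤ XP.length) :
    CinfExact.TabNear f B K c ρ (ofPacked w K o XP) := by
  have h0 : Encl.DataNear f (0 + B) K w o c ρ XP :=
    dataNear_extendRows hS (fun i _ hi t ht ↦ hbox i (by simpa using hi) t ht) Encl.DataNear.zeroRows h
  rw [Nat.zero_add] at h0
  exact TabNear.of_dataNear h0 hB

/-! ## The sector kernels are the door's printed `Kb` lambdas -/

/-- The EVEN sector kernel, unfolded: literally the C∞ door's even `Kb`. -/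
theorem sectorKernel_false_apply (G : ℤ → ℤ → ℝ) (n m : ℕ) :
    Encl.sectorKernel false G n m
      = (if n = 0 then G 0 m else if m = 0 then G n 0 else (G n m + G n (-(m : ℤ))) / 2) := rfl

/-- The ODD sector kernel, unfolded: literally the C∞ door's odd `Kb`. -/
theorem sectorKernel_true_apply (G : ℤ → ℤ → ℝ) (k l : ℕ) :
    Encl.sectorKernel true G k l = (G ((k : ℤ) + 1) ((l : ℤ) + 1) - G ((k : ℤ) + 1) (-((l : ℤ) + 1))) / 2 := rfl

/-- **K-columns of the pipeline, even sector**: format-C column data (`Encl.colDataNear_extendRows`, `odd = false`) is a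
claimed table of the door's even `Kb · (B + ·)`. -/
theorem kmTab_even {a : ℝ} {B K w o c ρ : ℕ} {XP : List ℕ}
    (h : Encl.DataNear (fun i t ↦ Encl.sectorKernel false (gramCoeff a) i (B + t)) B K w o c ρ XP) (hB : B ≤ XP.length) :
    CinfExact.TabNear (fun i t ↦ (fun n m : ℕ ↦ if n = 0 then gramCoeff a 0 m else if m = 0 then gramCoeff a n 0
        else (gramCoeff a n m + gramCoeff a n (-(m : ℤ))) / 2) i (B + t)) B K c ρ (ofPacked w K o XP) :=
  TabNear.of_dataNear h hB

/-- **K-columns of the pipeline, odd sector** (`odd = true`). -/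
theorem kmTab_odd {a : ℝ} {B K w o c ρ : ℕ} {XP : List ℕ}
    (h : Encl.DataNear (fun i t ↦ Encl.sectorKernel true (gramCoeff a) i (B + t)) B K w o c ρ XP) (hB : B ≤ XP.length) :
    CinfExact.TabNear (fun i t ↦ (fun n m : ℕ ↦ (gramCoeff a ((n : ℤ) + 1) ((m : ℤ) + 1)
        - gramCoeff a ((n : ℤ) + 1) (-((m : ℤ) + 1))) / 2) i (B + t)) B K c ρ (ofPacked w K o XP) :=
  TabNear.of_dataNear h hB

end CinfPacked

end Summit.RiemannHypothesis.RiemannHypothesis.Theorems.WeilFormatC
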